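import Summits.QuantumAdvantage.QuantumAdvantage.Theses.CommutingDeciders

/-! First lemma of the crux idea `planted-partition-forrelation` (elaboration check only; proof not required):
the Z4-weight statistic is the quadratic form of the diagonal operator `Λ = diag(i^{|w|})` (= `S^{⊗N}`) in the IQP
output state — step 1 of the identification with Bravyi–Gosset–Grier–Schaeffer's graph-based forrelation
`⟨0|H^N U_ḡ (HSH)^{⊗N} U_f H^N|0⟩`. -/

noncomputable section
namespace Summit.QuantumAdvantage.QuantumAdvantage.Cruxes.CommutingWitness.PlantedPartition
open scoped BigOperators Classical Matrix
open Literature.Computability.Cryptography Literature.Computability.Complexity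

/-- `Λ_N = diag(w ↦ i^{|w|})`, the Z4 weight character as a diagonal operator (equals `S^{⊗N}`). -/
def weightPhase (N : ℕ) : Matrix (QReg N) (QReg N) ℂ :=
  Matrix.diagonal fun w => Complex.I ^ (Finset.univ.filter (fun i : Fin N => w i = true)).card

/-- FIRST LEMMA (statement): `Σ_w |ψ_w|² i^{|w|} = ψ† Λ ψ` for the IQP output state `ψ = H D H |0^N⟩`. -/
def FirstLemma : Prop :=
  ∀ (N : ℕ) (D : QCircuit iqpDiag N),
    (∑ w : QReg N, ((‖(iqpUnitary D *ᵥ basisState (fun _ => false)) w‖ ^ 2 : ℝ) : ℂ) *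
        Complex.I ^ (Finset.univ.filter (fun i : Fin N => w i = true)).card)
      = star (iqpUnitary D *ᵥ basisState (fun _ => false)) ⬝ᵥ
          (weightPhase N *ᵥ (iqpUnitary D *ᵥ basisState (fun _ => false)))

/-- SECOND LEMMA (statement, the sandwich form): `ψ† Λ ψ = ⟨0| H D† H Λ H D H |0⟩` as a matrix entry, i.e. the
statistic is ONE amplitude of the depth-"IQP · S-layer · IQP†" circuit (a graph-based forrelation with `O_j = HSH`). -/
def SecondLemma : Prop :=
  ∀ (N : ℕ) (D : QCircuit iqpDiag N),
    star (iqpUnitary D *ᵥ basisState (fun _ => false)) ⬝ᵥ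
        (weightPhase N *ᵥ (iqpUnitary D *ᵥ basisState (fun _ => false)))
      = ((iqpUnitary D)ᴴ * weightPhase N * iqpUnitary D) (fun _ => false) (fun _ => false)

example : FirstLemma := by
  intro N D
  simp only [dotProduct, weightPhase, Matrix.mulVec_diagonal, Pi.star_apply]
  refine Finset.sum_congr rfl fun w _ => ?_
  set z : ℂ := (iqpUnitary D *ᵥ basisState (fun _ => false)) w with hz
  set k : ℕ := (Finset.univ.filter (fun i : Fin N => w i = true)).card with hk
  have h : star z * z = ((‖z‖ ^ 2 : ℝ) : ℂ) := by
    rw [Complex.star_def, mul_comm, Complex.mul_conj, Complex.normSq_eq_norm_sq]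
  calc ((‖z‖ ^ 2 : ℝ) : ℂ) * Complex.I ^ k = Complex.I ^ k * (star z * z) := by rw [h, mul_comm]
    _ = star z * (Complex.I ^ k * z) := by ring

end Summit.QuantumAdvantage.QuantumAdvantage.Cruxes.CommutingWitness.PlantedPartition
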